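import Summits.QuantumFields.YangMills.Theorems.UnitScaleTiltProp7SymFrameLinearResponseStepT3
import Literature.MathematicalPhysics.QuantumFieldTheory.Balaban1983to89.B7Prop3GeneralRotated
import Literature.MathematicalPhysics.QuantumFieldTheory.Balaban1983to89.B7GaugeFixingAtBackground
import HarnessLib

/-!
# Route `UnitScaleTilt`, crux K1 «MinimiserStabilityRegPr» (stmt-QuantumFields-19200), route-R E′ (A′)-on-Σ, P-A2-COMB (β), item «R0-RECURSION» (★★OWNER RULINGS №19∕№20), REM2ᶜ ⟸ `hMcomb₂`
# (★px17 g4's F-αᶜ∕F-βᶜ∕F-γᶜ), sub-brick R0-LIN-C FILE 3ᶜ — THE COMB TREE-RATIO DERIVATIVE IS THE TRANSPORTED SUM OF THE SINGLE-BAR DERIVATIVES: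
# `D[(R_{0,y}Ũ₁ʲ(t))(Γ)](a) v = (R_{0,y}Ẏ)(Γ)` = lit `B7Prop3GeneralRotated.tsum (Ū₀ʲ) (x κ ↦ D[Ũ₁ʲ(·)(x,κ)](a) v) y Γ` — for ANY differentiable units-valued family through `1`, any units background, any contour

Cell `ym3-torus`, twin-width seat `ym-routeR-w2` (gen 9); ★px17 g4 06:42:23Z «routeR-w2: 2ᶜ ∕ 3ᶜ GO — BOTH».  THE COMB TWIN of ✓`Prop7HolRatioLinearResponse` (R0-LIN-S FILE 3, `covWalkSum`
on the torus); here the `ℤᵈ` pullback letters of print's comb tower.  THEOREMS ONLY (0 `def`, 0 `sorry`); `--supports stmt-QuantumFields-19200 --as helper`, count-neutral.  YM₃ on T³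
is a ladder rung (R3), not the Clay problem; nothing here claims the stub, the crux, (β), `hPA2`, `hcoS`, d = 4 or the mass gap.

THE POINT.  ★px17's F-γᶜ2 (`Prop7CombFrameRem2RecursionT3.combFrameRem2_recursion_of_regPr`, SIGNATURE 3f7cc484) displays the comb `ℓ`-recursion
`hℓ : ℓ (l+1) ẑ = (Lᵈ)⁻¹ • Σ_r ( covTsum (avgIter L U₀♯ l) (ℓY l) (L•ẑ) (treeWord (boxVec L r)) + Ū₀ˡ(Γ_r) · ℓ l (L•ẑ + r) · Ū₀ˡ(Γ_r)⁻¹ )` (`covTsum` = lit `B7Prop3GeneralRotated.tsum`),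
to be inhabited (F-γᶜ3) by THE derivatives: `ℓ := fderiv (vcov …) 0 A` via ✓R0-LIN-C `Prop7CombFrameLinearResponseStep.fderiv_coe_vcov_succ_apply`, whose first summand is
`fderiv ℂ (t ↦ ↑(tHol (avgIter L U₀ j) (tildIter L U₀ (U₁ t) j) (L•z) (treeWord (boxVec L r)))) a A`.  This file identifies that derivative with `tsum`: lit proves the one-parameter,
flat-perturbation instance (✓`hasDerivAt_tHol_expCfg`: `d∕dt|₀ (R_{0,y}e^{tA})(Γ) = (R_{0,y}A)(Γ)`); here the Fréchet version for an ARBITRARY differentiable units-valued family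
`Z : E → (ℤᵈ-config)` with `Z a = 1` — the single-bar comb tower `t ↦ tildIter L U₀ (U₁ t) j` at `U₁ a = 1` is the case in point (lit ✓`tildIter_one_right`) — and an ARBITRARY units
background `V₀` (no unitarity: (58)'s `tHol V₀ V₁ = (V₁V₀)(Γ)·V₀(Γ)⁻¹` uses inverses):
* §1 `exists_hasFDerivAt_stepHol_mul` — one letter: `D[((Z·V₀))(±b)](a) v = tstep V₀ Ż_v x l · V₀(±b)` (forward: product rule; backward: ✓R0-LIN-S `hasFDerivAt_coe_inv_of_eq_one`).
* §2 `exists_hasFDerivAt_hol_mul` — the contour: `D[(Z·V₀)(Γ)](a) v = tsum V₀ Ż_v y Γ · V₀(Γ)` (induction = lit `tsum_cons`, the proof shape of ✓`hasDerivAt_hol_expCfg_mul`).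
* §3 ★★ `exists_hasFDerivAt_tHol` ∕ `differentiableAt_tHol` ∕ ★★★ `fderiv_tHol_apply` — `fderiv ℂ (t ↦ ↑(tHol V₀ (Z t) y Γ)) a v = tsum V₀ (x κ ↦ fderiv ℂ (t ↦ ↑(Z t x κ)) a v) y Γ`.
* §4 ★★★ `fderiv_combTreeRatio_apply` — at `Z t := tildIter L U₀ (U₁ t) j`, `V₀ := avgIter L U₀ j`, `U₁ a = 1`, under bondwise differentiability of the single-bar tower:
  `fderiv ℂ (t ↦ ↑(tHol (avgIter L U₀ j) (tildIter L U₀ (U₁ t) j) y Γ)) a v = tsum (avgIter L U₀ j) (x κ ↦ fderiv ℂ (t ↦ ↑(tildIter L U₀ (U₁ t) j x κ)) a v) y Γ` — ★px17's `covTsum … (ℓY l) …` with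
  `ℓY l x κ := fderiv ℂ (t ↦ ↑(tildIter … l x κ)) a v` TOKEN FOR TOKEN; `differentiableAt_combTreeRatio'` (re-export of ✓p702200's for the same hypotheses).
HONEST SCOPE.  Kinematics (calculus of finite products); no estimate, no smallness, no currency; nothing of print asserted beyond (58)'s bookkeeping; REM2ᶜ, `hMcomb₂`, (β), `hD`, `hPA2`,
`hcoS`, the stub and the crux are NOT advanced analytically by this file.

References: T. Bałaban, CMP 98 (1985) 17–51 [Balaban1985Averaging] ((8)–(9) p.18, (56)–(58) p.27, p.28, (69) p.29, (111) p.34).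
-/

set_option autoImplicit false

noncomputable section

open scoped Matrix.Norms.L2Operator BigOperators

namespace Summit.QuantumFields.YangMills.Theorems.Prop7CombTreeRatioLinearResponse

open NormedSpace
open Literature.MathematicalPhysics.QuantumFieldTheory.Balaban1983to89
open B7Prop1Explicit (hol hol_nil hol_cons stepHol Letter)
open B7Prop2Explicit (avgIter)
open B7Eq78Linearization (conjR conjR_apply)
open B7Eq92Concrete (tHol tildIter)
open B7Prop3GeneralRotated (tstep tsum tsum_nil tsum_cons)
open B7GaugeFixingAtBackground (tildIter_one_right)
open Summit.QuantumFields.YangMills.Theorems.Prop7SymFrameLinearResponseStep (hasFDerivAt_coe_inv_of_eq_one)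

variable {E : Type*} [NormedAddCommGroup E] [NormedSpace ℂ E]
  {𝔸 : Type*} [NormedRing 𝔸] [NormedAlgebra ℂ 𝔸] [CompleteSpace 𝔸]
variable {d : ℕ}
variable (V₀ : B7Prop1Explicit.Site d → Fin d → 𝔸ˣ) (Z : E → B7Prop1Explicit.Site d → Fin d → 𝔸ˣ) {a : E}

/-! ## §1 One letter -/

/-- **ONE LETTER**: for a bondwise-differentiable units family `Z` with `Z a = 1`, `t ↦ ↑((Z t · V₀)(±b))` (the step factor (9) of the product field) has a derivative at `a` whose value at
`v` is `tstep V₀ Ż_v x l · ↑(V₀(±b))`, `Ż_v x κ := Z′ x κ v` (forward: `Ż_v(b)·V₀(b)`; backward: `−V₀(b)⁻¹·Ż_v(b)`). [cite: Balaban1985Averaging, (9) p.18, (58) p.27, p.28] -/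
theorem exists_hasFDerivAt_stepHol_mul (hZa : Z a = 1) {Z' : B7Prop1Explicit.Site d → Fin d → E →L[ℂ] 𝔸}
    (hZ : ∀ x κ, HasFDerivAt (fun t => ((Z t x κ : 𝔸ˣ) : 𝔸)) (Z' x κ) a) (x : B7Prop1Explicit.Site d) (l : Letter d) :
    ∃ D : E →L[ℂ] 𝔸, HasFDerivAt (fun t => ((stepHol (Z t * V₀) x l : 𝔸ˣ) : 𝔸)) D a ∧
      ∀ v : E, D v = tstep V₀ (fun x κ => Z' x κ v) x l * ((stepHol V₀ x l : 𝔸ˣ) : 𝔸) := by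
  obtain ⟨μ, b⟩ := l
  cases b
  · -- backward letter: `((Z t · V₀) (x − e μ) μ)⁻¹ = V₀(b)⁻¹ · (Z t b)⁻¹`
    have heq : (fun t => ((stepHol (Z t * V₀) x (μ, false) : 𝔸ˣ) : 𝔸))
        = fun t => (((V₀ (x + Letter.vec (μ, false)) μ)⁻¹ : 𝔸ˣ) : 𝔸) * (((Z t (x + Letter.vec (μ, false)) μ)⁻¹ : 𝔸ˣ) : 𝔸) := by
      funext t
      simp only [stepHol, Bool.false_eq_true, ↓reduceIte, Pi.mul_apply, mul_inv_rev, Units.val_mul]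
    have h1 : Z a (x + Letter.vec (μ, false)) μ = 1 := by rw [hZa]; rfl
    have hd := (hasFDerivAt_coe_inv_of_eq_one (hZ (x + Letter.vec (μ, false)) μ) h1).const_mul
      ((((V₀ (x + Letter.vec (μ, false)) μ)⁻¹ : 𝔸ˣ) : 𝔸))
    refine ⟨_, by rw [heq]; exact hd, fun v => ?_⟩
    simp [tstep, stepHol, conjR_apply]
  · -- forward letter: `Z t b · V₀ b`
    have heq : (fun t => ((stepHol (Z t * V₀) x (μ, true) : 𝔸ˣ) : 𝔸)) = fun t => ((Z t x μ : 𝔸ˣ) : 𝔸) * ((V₀ x μ : 𝔸ˣ) : 𝔸) := by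
      funext t
      simp only [stepHol, ↓reduceIte, Pi.mul_apply, Units.val_mul]
    have hd := (hZ x μ).mul_const' (((V₀ x μ : 𝔸ˣ) : 𝔸))
    refine ⟨_, by rw [heq]; exact hd, fun v => ?_⟩
    simp [tstep, stepHol]

/-! ## §2 The contour -/

/-- **THE CONTOUR** (the product rule along the word = lit `tsum_cons`, as in ✓`hasDerivAt_hol_expCfg_mul`): `t ↦ ↑((Z t · V₀)(Γ))` has a derivative at `a` with value
`tsum V₀ Ż_v y Γ · ↑(V₀(Γ))`. [cite: Balaban1985Averaging, (58) p.27, p.28, (111) p.34] -/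
theorem exists_hasFDerivAt_hol_mul (hZa : Z a = 1) {Z' : B7Prop1Explicit.Site d → Fin d → E →L[ℂ] 𝔸}
    (hZ : ∀ x κ, HasFDerivAt (fun t => ((Z t x κ : 𝔸ˣ) : 𝔸)) (Z' x κ) a) :
    ∀ (w : List (Letter d)) (y : B7Prop1Explicit.Site d), ∃ D : E →L[ℂ] 𝔸, HasFDerivAt (fun t => ((hol (Z t * V₀) y w : 𝔸ˣ) : 𝔸)) D a ∧
      ∀ v : E, D v = tsum V₀ (fun x κ => Z' x κ v) y w * ((hol V₀ y w : 𝔸ˣ) : 𝔸)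
  | [], y => ⟨0, by simp only [hol_nil, Units.val_one]; exact hasFDerivAt_const _ _, fun v => by simp⟩
  | l :: w, y => by
    obtain ⟨Ds, hs, hsv⟩ := exists_hasFDerivAt_stepHol_mul V₀ Z hZa hZ y l
    obtain ⟨Dw, hw, hwv⟩ := exists_hasFDerivAt_hol_mul hZa hZ w (y + l.vec)
    have heq : (fun t => ((hol (Z t * V₀) y (l :: w) : 𝔸ˣ) : 𝔸)) = fun t => ((stepHol (Z t * V₀) y l : 𝔸ˣ) : 𝔸) * ((hol (Z t * V₀) (y + l.vec) w : 𝔸ˣ) : 𝔸) := by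
      funext t; rw [hol_cons, Units.val_mul]
    have hs1 : stepHol (Z a * V₀) y l = stepHol V₀ y l := by rw [hZa, one_mul]
    have hw1 : hol (Z a * V₀) (y + l.vec) w = hol V₀ (y + l.vec) w := by rw [hZa, one_mul]
    refine ⟨_, by rw [heq]; exact hs.mul' hw, fun v => ?_⟩
    simp only [add_apply, smul_apply, hsv v, hwv v, hs1, hw1, smul_eq_mul, MulOpposite.smul_eq_mul_unop, MulOpposite.unop_op,
      tsum_cons, hol_cons, Units.val_mul, conjR_apply, add_mul]
    simp only [mul_assoc, Units.inv_mul_cancel_left]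
    exact add_comm _ _

/-! ## §3 ★★★ The twisted transport (58) -/

/-- ★★ **`D[(R_{0,y}Z(·))(Γ)](a) v = (R_{0,y}Ż_v)(Γ)`**: for a bondwise-differentiable units family `Z` through `1` and ANY units background `V₀`, the twisted transport
`t ↦ ↑(tHol V₀ (Z t) y Γ) = ↑((Z t·V₀)(Γ)·V₀(Γ)⁻¹)` has a derivative at `a` with value `tsum V₀ (x κ ↦ Z′ x κ v) y Γ`. [cite: Balaban1985Averaging, (58) p.27, p.28, (111) p.34] -/
theorem exists_hasFDerivAt_tHol (hZa : Z a = 1) {Z' : B7Prop1Explicit.Site d → Fin d → E →L[ℂ] 𝔸}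
    (hZ : ∀ x κ, HasFDerivAt (fun t => ((Z t x κ : 𝔸ˣ) : 𝔸)) (Z' x κ) a) (y : B7Prop1Explicit.Site d) (w : List (Letter d)) :
    ∃ D : E →L[ℂ] 𝔸, HasFDerivAt (fun t => ((tHol V₀ (Z t) y w : 𝔸ˣ) : 𝔸)) D a ∧ ∀ v : E, D v = tsum V₀ (fun x κ => Z' x κ v) y w := by
  obtain ⟨Dw, hw, hwv⟩ := exists_hasFDerivAt_hol_mul V₀ Z hZa hZ w y
  have heq : (fun t => ((tHol V₀ (Z t) y w : 𝔸ˣ) : 𝔸)) = fun t => ((hol (Z t * V₀) y w : 𝔸ˣ) : 𝔸) * (((hol V₀ y w)⁻¹ : 𝔸ˣ) : 𝔸) := by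
    funext t; rw [tHol, Units.val_mul]
  refine ⟨Dw.smulRight ((((hol V₀ y w)⁻¹ : 𝔸ˣ)) : 𝔸), by rw [heq]; exact hw.mul_const' _, fun v => ?_⟩
  rw [ContinuousLinearMap.smulRight_apply, hwv v, smul_eq_mul, mul_assoc, Units.mul_inv, mul_one]

/-- `t ↦ ↑(tHol V₀ (Z t) y Γ)` is differentiable at `a`. [cite: Balaban1985Averaging, (58) p.27] -/
theorem differentiableAt_tHol (hZa : Z a = 1) (hZ : ∀ x κ, DifferentiableAt ℂ (fun t => ((Z t x κ : 𝔸ˣ) : 𝔸)) a)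
    (y : B7Prop1Explicit.Site d) (w : List (Letter d)) :
    DifferentiableAt ℂ (fun t => ((tHol V₀ (Z t) y w : 𝔸ˣ) : 𝔸)) a := by
  obtain ⟨D, hD, -⟩ := exists_hasFDerivAt_tHol V₀ Z hZa (fun x κ => (hZ x κ).hasFDerivAt) y w
  exact hD.differentiableAt

/-- ★★★ **APPLIED FORM**: under bondwise differentiability of `Z` at `a` with `Z a = 1`,
`fderiv ℂ (t ↦ ↑(tHol V₀ (Z t) y Γ)) a v = tsum V₀ (x κ ↦ fderiv ℂ (t ↦ ↑(Z t x κ)) a v) y Γ`. [cite: Balaban1985Averaging, (58) p.27, p.28, (111) p.34] -/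
theorem fderiv_tHol_apply (hZa : Z a = 1) (hZ : ∀ x κ, DifferentiableAt ℂ (fun t => ((Z t x κ : 𝔸ˣ) : 𝔸)) a)
    (y : B7Prop1Explicit.Site d) (w : List (Letter d)) (v : E) :
    fderiv ℂ (fun t => ((tHol V₀ (Z t) y w : 𝔸ˣ) : 𝔸)) a v = tsum V₀ (fun x κ => fderiv ℂ (fun t => ((Z t x κ : 𝔸ˣ) : 𝔸)) a v) y w := by
  obtain ⟨D, hD, hDv⟩ := exists_hasFDerivAt_tHol V₀ Z hZa (fun x κ => (hZ x κ).hasFDerivAt) y w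
  rw [hD.fderiv, hDv]

/-! ## §4 ★★★ PRINT's comb tower: the single-bar tree ratios -/

section Comb

variable (L : ℕ) (U₀ : B7Prop1Explicit.Site d → Fin d → 𝔸ˣ) (U₁ : E → B7Prop1Explicit.Site d → Fin d → 𝔸ˣ)

/-- ★★★ **THE COMB TREE-RATIO DERIVATIVE IS `tsum` OF THE SINGLE-BAR DERIVATIVES** (★px17 F-γᶜ2's `covTsum … (ℓY l) …` letter with `ℓY l x κ := fderiv ℂ (t ↦ ↑(Ũ₁ˡ(t)(x,κ))) a v`): for a
perturbation family `U₁` with `U₁ a = 1` (so `Ũ₁ʲ(a) = 1`, lit ✓`tildIter_one_right`) and bondwise-differentiable single-bar tower `t ↦ ↑(tildIter L U₀ (U₁ t) j x κ)` at `a`, for every base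
`y` and contour `Γ` (in particular `y = L•z`, `Γ = treeWord (boxVec L r)` of ✓p702200 `fderiv_coe_vcov_succ_apply`'s first summand),
`fderiv ℂ (t ↦ ↑(tHol (avgIter L U₀ j) (tildIter L U₀ (U₁ t) j) y Γ)) a v = tsum (avgIter L U₀ j) (x κ ↦ fderiv ℂ (t ↦ ↑(tildIter L U₀ (U₁ t) j x κ)) a v) y Γ`.
[cite: Balaban1985Averaging, (58) p.27, (69) p.29, (85) p.31, (111) p.34] -/
theorem fderiv_combTreeRatio_apply (hU₁ : U₁ a = 1) (j : ℕ)
    (hT : ∀ x κ, DifferentiableAt ℂ (fun t => ((tildIter L U₀ (U₁ t) j x κ : 𝔸ˣ) : 𝔸)) a)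
    (y : B7Prop1Explicit.Site d) (w : List (Letter d)) (v : E) :
    DifferentiableAt ℂ (fun t => ((tHol (avgIter L U₀ j) (tildIter L U₀ (U₁ t) j) y w : 𝔸ˣ) : 𝔸)) a ∧
    fderiv ℂ (fun t => ((tHol (avgIter L U₀ j) (tildIter L U₀ (U₁ t) j) y w : 𝔸ˣ) : 𝔸)) a v
      = tsum (avgIter L U₀ j) (fun x κ => fderiv ℂ (fun t => ((tildIter L U₀ (U₁ t) j x κ : 𝔸ˣ) : 𝔸)) a v) y w := by
  have hZa : (fun t => tildIter L U₀ (U₁ t) j) a = 1 := by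
    show tildIter L U₀ (U₁ a) j = 1
    rw [hU₁, tildIter_one_right]
  exact ⟨differentiableAt_tHol (avgIter L U₀ j) (fun t => tildIter L U₀ (U₁ t) j) hZa hT y w,
    fderiv_tHol_apply (avgIter L U₀ j) (fun t => tildIter L U₀ (U₁ t) j) hZa hT y w v⟩

/-- ★★ **`HasFDerivAt` FORM WITH CANDIDATE SINGLE-BAR DERIVATIVES** (for consumers carrying `HasFDerivAt` rows): if `t ↦ ↑(Ũ₁ʲ(t)(x,κ))` has derivative `T x κ` at `a` bondwise, then the
tree ratio has a derivative `D` with `D v = tsum (avgIter L U₀ j) (x κ ↦ T x κ v) y Γ`. [cite: Balaban1985Averaging, (58) p.27, (111) p.34] -/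
theorem exists_hasFDerivAt_combTreeRatio (hU₁ : U₁ a = 1) (j : ℕ) {T : B7Prop1Explicit.Site d → Fin d → E →L[ℂ] 𝔸}
    (hT : ∀ x κ, HasFDerivAt (fun t => ((tildIter L U₀ (U₁ t) j x κ : 𝔸ˣ) : 𝔸)) (T x κ) a)
    (y : B7Prop1Explicit.Site d) (w : List (Letter d)) :
    ∃ D : E →L[ℂ] 𝔸, HasFDerivAt (fun t => ((tHol (avgIter L U₀ j) (tildIter L U₀ (U₁ t) j) y w : 𝔸ˣ) : 𝔸)) D a ∧
      ∀ v : E, D v = tsum (avgIter L U₀ j) (fun x κ => T x κ v) y w := by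
  have hZa : (fun t => tildIter L U₀ (U₁ t) j) a = 1 := by
    show tildIter L U₀ (U₁ a) j = 1
    rw [hU₁, tildIter_one_right]
  exact exists_hasFDerivAt_tHol (avgIter L U₀ j) (fun t => tildIter L U₀ (U₁ t) j) hZa hT y w

end Comb

end Summit.QuantumFields.YangMills.Theorems.Prop7CombTreeRatioLinearResponse

end
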